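import Summits.ResolutionOfSingularities.ResolutionOfSingularities.Theorems.FrobeniusClosingSteerVertexShiftRigidity
import Summits.ResolutionOfSingularities.ResolutionOfSingularities.Theorems.FrobeniusClosingSteerAnisotropicNoAlmostPower
import Summits.ResolutionOfSingularities.ResolutionOfSingularities.Theorems.FrobeniusClosingSteerIntegralVertexDescent
import HarnessLib

/-!
# Crux `Steer` (stmt-ResolutionOfSingularities-16345), chain W4.1 — §11 DESCENT TRIO, CLOSING ONE-LINER:
# **`integralVertexDescent_holds : IntegralVertexDescent`** (unconditional)

OURS (campaign `res-hironaka`, rung L ★L-G4, slot W4.1; a kernel proof of the route's own word `VertexDescent.IntegralVertexDescent`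
of FILE 0 `…Theorems.FrobeniusClosingSteerVertexDescentWords` (p549379, res-L0-w41-idea-1 g10's `VertexDescent-idea-1-g10.lean`
5662ba702317d2c3 VERBATIM); it replaces the role of no printed item and is NOT a statement of the manuscript under review
[claim: Hironaka2017, status: under-review]; AI-produced, AI review is weaker than expert review). The §11 trio of res-L0-w41-plan-1
RULING 189c/194b: FILE 1 `…SteerVertexShiftRigidity(A)` (`vertexShiftRigidity_holds`, res-D-repro-2 g9, p551143 + p552119) · FILE 2
`…SteerAnisotropicNoAlmostPower` (`anisotropicNoAlmostPower_holds`, res-L1-type-o6, p550207) · FILE 3 `…SteerIntegralVertexDescent`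
(Galois glue `integralVertexDescent_of (hR) (hA)`, res-L1-type-o6, p551075). This module only composes the three tree theorems
(res-L0-w41-plan-1 RULING 206(c)/213(b): closing append filed by res-D-repro-2 as a separate def-free module). INTEGRAL-VERTEX DESCENT
(memo `CANONICAL-CLEANING-g10.md` 2ea9717796005c14 §11): `κ` perfect of characteristic `2`, `κ'/κ` algebraic, `F` a form of odd degree
`d ≥ 3` over `κ` with anisotropic cone — every vector `c ∈ κ'²` dissolving `F ⊗ κ'` is `κ`-rational. Def-free; no Theses import; nothing here
is a route item or a registration.
-/

-- `Summit.<S>.<S>.…` duplicates the summit name by design (single-problem summit).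
set_option linter.dupNamespace false
set_option autoImplicit false

namespace Summit.ResolutionOfSingularities.ResolutionOfSingularities.Theorems.SwitchingDichotomy.VertexDescent

/-- **INTEGRAL-VERTEX DESCENT**, unconditional: the FILE 0 word `IntegralVertexDescent` holds — composed from
`vertexShiftRigidity_holds` (FILE 1B), `anisotropicNoAlmostPower_holds` (FILE 2) and the Galois glue `integralVertexDescent_of`
(FILE 3). Consequently an integral vertex undissolvable over a perfect `κ` of characteristic `2` stays undissolvable over every
algebraic residue-field extension (memo §11 COROLLARY; the `XLetterLawIrrEscHat` descent step). [folklore] -/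
theorem integralVertexDescent_holds : IntegralVertexDescent :=
  integralVertexDescent_of vertexShiftRigidity_holds anisotropicNoAlmostPower_holds

end Summit.ResolutionOfSingularities.ResolutionOfSingularities.Theorems.SwitchingDichotomy.VertexDescent
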